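import Mathlib
import HarnessLib
import Summits.AtomisticToContinuum.Crystallization.Theorems.PricedLinkCensusSoftFourRingsReduction
import Summits.AtomisticToContinuum.Crystallization.Theorems.PricedLinkCensusSoftFourRingsBridge
import Summits.AtomisticToContinuum.Crystallization.Theorems.PricedLinkCensusSoftFourRingsCapInterior
import Summits.AtomisticToContinuum.Crystallization.Theorems.PricedLinkCensusSoftFourRingsCapNoSlack
import Summits.AtomisticToContinuum.Crystallization.Theorems.PricedLinkCensusSoftFourRingsCapGlobal
import Summits.AtomisticToContinuum.Crystallization.Theorems.PricedLinkCensusSoftFourRingsDefs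

/-!
# Soft four-rings: assembly modulo endgame rigidity — `Cap` variant

Route `PricedLinkCensus`, sub-problem `Crystallization`, item `SoftFourRings`
(stmt-AtomisticToContinuum-14234).  `Cap` variant (seat c3) of
`PricedLinkCensusSoftFourRingsAssembly`: the global Tammes-13 hypothesis is replaced by the
**bond-to-cap implication** — in the hull-level setting of the twelve-point reduction (twelve unit
directions pairwise at cosine `≤ 1 − 1/(2·1.01²)`, `24` bonds at cosine `≥ 1 − 1.01²/2`, four at
every point, non-bonds at cosine `< 1.01/2`) every unit vector is within chordal distance `0.957`
of a direction (no empty cap of angular radius `57.18°`).  That implication is the subject of the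
`PricedLinkCensusSoftFourRingsCapCert*` files; here it is a hypothesis, stated inline.

`softFourRings_of_endgameRigidity` :
  `(bond-to-cap) → δ ≤ 6/25 → EndgameRigidity δ → SoftFourRings`.
-/

namespace Summit.AtomisticToContinuum.Crystallization.Theorems.Cap

open Real RealInnerProductSpace Literature.Geometry.DiscreteGeometry

/-- **`SoftFourRings` modulo the bond-to-cap implication and endgame rigidity.** -/
theorem softFourRings_of_endgameRigidity
    (hC : ∀ (X : Finset (EuclideanSpace ℝ (Fin 3))) (B : Finset (Finset (EuclideanSpace ℝ (Fin 3)))),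
      (∀ y ∈ X, ‖y‖ = 1) → X.card = 12 →
      (∀ u ∈ X, ∀ u' ∈ X, u ≠ u' → ⟪u, u'⟫ ≤ 1 - 1 / (2 * (101 / 100 : ℝ) ^ 2)) →
      (∀ T ∈ B, ∃ u ∈ X, ∃ u' ∈ X, u ≠ u' ∧ 1 - (101 / 100 : ℝ) ^ 2 / 2 ≤ ⟪u, u'⟫ ∧
        T = {u, u'}) →
      B.card = 24 →
      (∀ v ∈ X, ∃ w : Fin 4 → EuclideanSpace ℝ (Fin 3), (∀ k, w k ∈ X) ∧
        Function.Injective w ∧ (∀ k, w k ≠ v) ∧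
        (∀ k, ({v, w k} : Finset (EuclideanSpace ℝ (Fin 3))) ∈ B) ∧
        ∀ y, ({v, y} : Finset (EuclideanSpace ℝ (Fin 3))) ∈ B → ∃ k, y = w k) →
      (∀ u ∈ X, ∀ u' ∈ X, u ≠ u' → ({u, u'} : Finset (EuclideanSpace ℝ (Fin 3))) ∉ B →
        ⟪u, u'⟫ < 101 / 200) →
      ∀ p : EuclideanSpace ℝ (Fin 3), ‖p‖ = 1 → ∃ x ∈ X, dist p x < 0.957)
    {δ : ℝ} (hδ : δ ≤ 6 / 25) (hER : EndgameRigidity δ) :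
    Summit.AtomisticToContinuum.Crystallization.Theses.PricedLinkCensus.SoftFourRings := by
  refine softFourRings_of_twelve_unit fun η hη hη1 z n h1 h2 h3 h4 h5 => ?_
  obtain ⟨X, B, hX1, hcard, hsepX, hB, hBcard, hdeg, hnonbond, hclose⟩ :=
    hull_setting_of_twelve hη hη1 h1 h2 h3 h4 h5
  have hT : ∀ p : EuclideanSpace ℝ (Fin 3), ‖p‖ = 1 → ∃ x ∈ X, dist p x < 0.957 :=
    hC X B hX1 hcard hsepX hB hBcard hdeg hnonbond
  have h0 : (0 : EuclideanSpace ℝ (Fin 3)) ∈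
      interior (convexHull ℝ (X : Set (EuclideanSpace ℝ (Fin 3)))) :=
    zero_mem_interior_convexHull_of_twelve_le_card hT hX1 hcard.ge
      (ca := 1 - 1 / (2 * (101 / 100 : ℝ) ^ 2)) (by norm_num) hsepX
  obtain ⟨-, -, -, -, -, h34, -, -⟩ := hull_counts_of_twelve hT hX1 hcard hsepX hB hBcard
  obtain ⟨hT8, ht2⟩ := no_slack_one_percent hT hX1 hcard hsepX hB hBcard hdeg
  obtain ⟨A, P, hP, hAP⟩ := hER X B hX1 hcard hsepX hB hBcard hdeg hnonbond h0 h34 hT8 ht2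
  refine ⟨A, P, hP, fun p hp => ?_⟩
  obtain ⟨x, hx, hd⟩ := hAP p hp
  obtain ⟨j, hj⟩ := hclose x hx
  exact ⟨j, by linarith [dist_triangle (z j) x (A p)]⟩

end Summit.AtomisticToContinuum.Crystallization.Theorems.Cap
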